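import Literature.Computability.AlgebraicComplexity.LaserMethodRestriction
import HarnessLib

/-!
# Route OctonionicLaser — `OctLaserBound` (stmt-MatrixMultiplication-7934), helper file 1/2:
# free diagonals with SIGNED matrix components are restrictions

Support lemmas for `Summits/MatrixMultiplication/MatrixMultiplication/Theorems/OctonionicLaserOctLaserBound.lean`.
The tree's tensor layer of the laser method (`LaserMethodRestriction.lean`, BCS Prop. 15.30 with the
proof of Thm. 15.41) asks every `D`-component of the carrier `t` to be LITERALLY a matrix tensor
`⟨k,m,n⟩` along index maps into the blocks.  The coarse blocks of the octonion tensor `t₈` are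
matrix tensors only up to SIGNS (the Cayley–Dickson twist; the signs are not removable by a global
diagonal base change), so we re-prove that layer for components of the form
`εI(u) εJ(v) εL(w) · ⟨k s, m s, n s⟩(u, v, w)` with per-component sign functions, `ε · ε = 1`:

* `tensorRestrictsTo_precomp_smul` — signed relabelling / zeroing-out is a restriction;
* `matMulDirectSum_eq_signed_kroneckerPow_laserIndex`,
  `tensorRestrictsTo_kroneckerPow_matMulDirectSum_of_free_signed` — for a free diagonal `d` of
  `S^N`-supported label triples, `t^{⊗N} ≥ ⊕ᵢ ⟨∏_ρ k, ∏_ρ m, ∏_ρ n⟩` (a diagonal meets every block of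
  `t^{⊗N}` at most once, so the component-wise signed relabellings glue to ONE monomial restriction).

Everything proved over a commutative semiring; no definitions, no named facts.

## References

* [BurgisserClausenShokrollahi1997] P. Bürgisser, M. Clausen, M. A. Shokrollahi, *Algebraic
  Complexity Theory*, Springer 1997, §15.6 Prop. 15.30, §15.8 Thm. 15.41 (proof, p. 381).
* [Blaser2013] M. Bläser, *Fast Matrix Multiplication*, ToC Graduate Surveys 5 (2013), Def. 7.2, §8.
-/

noncomputable section

open scoped BigOperators
open Finset

-- the tree's namespace `Summit.MatrixMultiplication.MatrixMultiplication.…` repeats a component by design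
set_option linter.dupNamespace false

namespace Summit.MatrixMultiplication.MatrixMultiplication.Theorems

open Literature.Computability.AlgebraicComplexity

universe u

/-! ## Signed relabellings are restrictions -/

section SignedPrecomp

variable {K : Type u} [CommSemiring K]
variable {ι κ μ ι' κ' μ' : Type*}

/-- **Signed zeroing-out / relabelling is a restriction**: `t ≥ (a,b,c) ↦ α(a) β(b) γ(c) · t(f a, g b, h c)`
(monomial matrices; Bläser 2013, Def. 7.2 with scalars). [folklore] -/
theorem tensorRestrictsTo_precomp_smul [Fintype ι] [Fintype κ] [Fintype μ] [DecidableEq ι]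
    [DecidableEq κ] [DecidableEq μ] (t : ι → κ → μ → K) (f : ι' → ι) (g : κ' → κ) (h : μ' → μ)
    (α : ι' → K) (β : κ' → K) (γ : μ' → K) :
    TensorRestrictsTo t (fun a b c => α a * β b * γ c * t (f a) (g b) (h c)) := by
  refine ⟨fun a' a => if f a' = a then α a' else 0, fun b' b => if g b' = b then β b' else 0,
    fun c' c => if h c' = c then γ c' else 0, fun a' b' c' => ?_⟩
  rw [Finset.sum_eq_single (f a') (fun a _ ha => by simp [Ne.symm ha]) (by simp),
    Finset.sum_eq_single (g b') (fun b _ hb => by simp [Ne.symm hb]) (by simp),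
    Finset.sum_eq_single (h c') (fun c _ hc => by simp [Ne.symm hc]) (by simp)]
  simp

end SignedPrecomp

/-! ## Free diagonals with signed matrix components (BCS Prop. 15.30, signed form) -/

section SignedFreeDiagonal

variable {K : Type u} [CommSemiring K]
variable {ι κ μ : Type*} [Fintype ι] [Fintype κ] [Fintype μ] [DecidableEq ι] [DecidableEq κ]
  [DecidableEq μ]
variable {I J L : Type*}

omit [Fintype ι] [Fintype κ] [Fintype μ] [DecidableEq ι] [DecidableEq κ] [DecidableEq μ] in
/-- **The blocks of a free diagonal, entrywise, for SIGNED matrix components**: as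
`matMulDirectSum_eq_kroneckerPow_laserIndex` (BCS Prop. 15.30 with the proof of Thm. 15.41), but the
component of `t` at `s ∈ S` is only required to be `εI(u) εJ(v) εL(w) · ⟨k s, m s, n s⟩(u,v,w)` along
the index maps, for sign functions with `ε · ε = 1`; the direct sum `⊕ᵢ ⟨∏k, ∏m, ∏n⟩` over a free
diagonal `d` is then entrywise the pull-back of `t^{⊗N}` times the product of the signs of the digits.
[cite: BurgisserClausenShokrollahi1997, Prop. 15.30 and Thm. 15.41 (proof, p. 381)] -/
theorem matMulDirectSum_eq_signed_kroneckerPow_laserIndex (t : ι → κ → μ → K) (bI : ι → I)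
    (bJ : κ → J) (bL : μ → L) (S : Finset (I × J × L))
    (hS : ∀ a b c, t a b c ≠ 0 → (bI a, bJ b, bL c) ∈ S)
    (k m n : I × J × L → ℕ) (eI : ∀ s, Fin (k s) × Fin (n s) → ι)
    (eJ : ∀ s, Fin (k s) × Fin (m s) → κ) (eL : ∀ s, Fin (m s) × Fin (n s) → μ)
    (εI : ∀ s, Fin (k s) × Fin (n s) → K) (εJ : ∀ s, Fin (k s) × Fin (m s) → K)
    (εL : ∀ s, Fin (m s) × Fin (n s) → K)
    (heI : ∀ s ∈ S, ∀ u, bI (eI s u) = s.1) (heJ : ∀ s ∈ S, ∀ v, bJ (eJ s v) = s.2.1)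
    (heL : ∀ s ∈ S, ∀ w, bL (eL s w) = s.2.2)
    (hεI : ∀ s ∈ S, ∀ u, εI s u * εI s u = 1) (hεJ : ∀ s ∈ S, ∀ v, εJ s v * εJ s v = 1)
    (hεL : ∀ s ∈ S, ∀ w, εL s w * εL s w = 1)
    (hmat : ∀ s ∈ S, ∀ u v w, t (eI s u) (eJ s v) (eL s w) =
      εI s u * εJ s v * εL s w * matMulTensor K (k s) (m s) (n s) u v w)
    {N p : ℕ} (d : Fin p → (Fin N → I) × (Fin N → J) × (Fin N → L))
    (hdS : ∀ i ρ, labelSeq (d i) ρ ∈ S)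
    (hfree : ∀ i i' i'', (∀ ρ, ((d i).1 ρ, (d i').2.1 ρ, (d i'').2.2 ρ) ∈ S) → i = i' ∧ i' = i'')
    (a : Σ i : Fin p, Fin (∏ ρ, k (labelSeq (d i) ρ)) × Fin (∏ ρ, n (labelSeq (d i) ρ)))
    (b : Σ i : Fin p, Fin (∏ ρ, k (labelSeq (d i) ρ)) × Fin (∏ ρ, m (labelSeq (d i) ρ)))
    (c : Σ i : Fin p, Fin (∏ ρ, m (labelSeq (d i) ρ)) × Fin (∏ ρ, n (labelSeq (d i) ρ))) :
    matMulDirectSum K (fun i => ∏ ρ, k (labelSeq (d i) ρ)) (fun i => ∏ ρ, m (labelSeq (d i) ρ))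
        (fun i => ∏ ρ, n (labelSeq (d i) ρ)) a b c =
      ((∏ ρ, εI (labelSeq (d a.1) ρ) (finPiFinEquiv.symm a.2.1 ρ, finPiFinEquiv.symm a.2.2 ρ)) *
        (∏ ρ, εJ (labelSeq (d b.1) ρ) (finPiFinEquiv.symm b.2.1 ρ, finPiFinEquiv.symm b.2.2 ρ)) *
        (∏ ρ, εL (labelSeq (d c.1) ρ) (finPiFinEquiv.symm c.2.1 ρ, finPiFinEquiv.symm c.2.2 ρ))) *
      kroneckerPow t N (laserIndex₁ k n eI (labelSeq (d a.1)) a.2)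
        (laserIndex₂ k m eJ (labelSeq (d b.1)) b.2) (laserIndex₃ m n eL (labelSeq (d c.1)) c.2) := by
  classical
  obtain ⟨i, u⟩ := a
  obtain ⟨i', v⟩ := b
  obtain ⟨i'', w⟩ := c
  by_cases hdiag : i = i' ∧ i' = i''
  · -- a diagonal block: the component is the signed matrix tensor, digit by digit
    obtain ⟨rfl, rfl⟩ := hdiag
    rw [matMulDirectSum_block, kroneckerPow_apply]
    simp only [laserIndex₁_apply, laserIndex₂_apply, laserIndex₃_apply]
    rw [Finset.prod_congr rfl fun ρ _ => hmat _ (hdS i ρ) _ _ _]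
    rw [Finset.prod_mul_distrib, Finset.prod_mul_distrib, Finset.prod_mul_distrib]
    -- the sign products square to one
    set PI := ∏ ρ, εI (labelSeq (d i) ρ) (finPiFinEquiv.symm u.1 ρ, finPiFinEquiv.symm u.2 ρ)
    set PJ := ∏ ρ, εJ (labelSeq (d i) ρ) (finPiFinEquiv.symm v.1 ρ, finPiFinEquiv.symm v.2 ρ)
    set PL := ∏ ρ, εL (labelSeq (d i) ρ) (finPiFinEquiv.symm w.1 ρ, finPiFinEquiv.symm w.2 ρ)
    have hPI : PI * PI = 1 := by
      rw [← Finset.prod_mul_distrib]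
      exact Finset.prod_eq_one fun ρ _ => hεI _ (hdS i ρ) _
    have hPJ : PJ * PJ = 1 := by
      rw [← Finset.prod_mul_distrib]
      exact Finset.prod_eq_one fun ρ _ => hεJ _ (hdS i ρ) _
    have hPL : PL * PL = 1 := by
      rw [← Finset.prod_mul_distrib]
      exact Finset.prod_eq_one fun ρ _ => hεL _ (hdS i ρ) _
    set M := ∏ ρ, matMulTensor K (k (labelSeq (d i) ρ)) (m (labelSeq (d i) ρ)) (n (labelSeq (d i) ρ))
      (finPiFinEquiv.symm u.1 ρ, finPiFinEquiv.symm u.2 ρ)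
      (finPiFinEquiv.symm v.1 ρ, finPiFinEquiv.symm v.2 ρ)
      (finPiFinEquiv.symm w.1 ρ, finPiFinEquiv.symm w.2 ρ) with hM
    have hsq : PI * PJ * PL * (PI * PJ * PL * M) = (PI * PI) * (PJ * PJ) * (PL * PL) * M := by ring
    rw [hsq, hPI, hPJ, hPL, one_mul, one_mul, one_mul, hM]
    simp only [matMulTensor, Fintype.prod_boole]
    have hiff : (u.1 = v.1 ∧ v.2 = w.1 ∧ u.2 = w.2) ↔
        ∀ ρ, finPiFinEquiv.symm u.1 ρ = finPiFinEquiv.symm v.1 ρ ∧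
          finPiFinEquiv.symm v.2 ρ = finPiFinEquiv.symm w.1 ρ ∧
          finPiFinEquiv.symm u.2 ρ = finPiFinEquiv.symm w.2 ρ := by
      rw [← finPiFinEquiv.symm.injective.eq_iff (a := u.1), ← finPiFinEquiv.symm.injective.eq_iff
        (a := v.2), ← finPiFinEquiv.symm.injective.eq_iff (a := u.2)]
      simp only [funext_iff]
      exact ⟨fun h ρ => ⟨h.1 ρ, h.2.1 ρ, h.2.2 ρ⟩,
        fun h => ⟨fun ρ => (h ρ).1, fun ρ => (h ρ).2.1, fun ρ => (h ρ).2.2⟩⟩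
    by_cases h : u.1 = v.1 ∧ v.2 = w.1 ∧ u.2 = w.2
    · rw [if_pos h, if_pos (hiff.1 h)]
    · rw [if_neg h, if_neg (mt hiff.2 h)]
  · -- off the diagonal both sides vanish: a non-zero entry of `t^{⊗N}` would put
    -- `(x_{d i}, y_{d i'}, z_{d i''})` into `S^N`, contradicting freeness
    rw [matMulDirectSum_of_ne _ _ _ _ (not_and_or.mp hdiag)]
    symm
    apply mul_eq_zero_of_right
    by_contra hne
    rw [kroneckerPow_apply] at hne
    refine hdiag (hfree i i' i'' fun ρ => ?_)
    have hρ : t (laserIndex₁ k n eI (labelSeq (d i)) u ρ) (laserIndex₂ k m eJ (labelSeq (d i')) v ρ)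
        (laserIndex₃ m n eL (labelSeq (d i'')) w ρ) ≠ 0 := fun h0 =>
      hne (Finset.prod_eq_zero (Finset.mem_univ ρ) h0)
    have h := hS _ _ _ hρ
    simp only [laserIndex₁_apply, laserIndex₂_apply, laserIndex₃_apply] at h
    rwa [heI _ (hdS i ρ), heJ _ (hdS i' ρ), heL _ (hdS i'' ρ)] at h

/-- **`⊕_{δ ∈ Δ} t^{⊗N}(x_δ, y_δ, z_δ) ≤ t^{⊗N}` for a free diagonal `Δ`, signed components** (BCS
Prop. 15.30, used on p. 381, with hypothesis (2) of Thm. 15.41 — "all `D`-components are isomorphic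
to matrix tensors" — for isomorphisms that are SIGNED relabellings inside the blocks): `t^{⊗N}`
restricts to the direct sum of the matrix tensors `⟨∏_ρ k s_ρ, ∏_ρ m s_ρ, ∏_ρ n s_ρ⟩` over the
members of the free diagonal. [cite: BurgisserClausenShokrollahi1997, Prop. 15.30 and Thm. 15.41 (proof, p. 381)] -/
theorem tensorRestrictsTo_kroneckerPow_matMulDirectSum_of_free_signed (t : ι → κ → μ → K)
    (bI : ι → I) (bJ : κ → J) (bL : μ → L) (S : Finset (I × J × L))
    (hS : ∀ a b c, t a b c ≠ 0 → (bI a, bJ b, bL c) ∈ S)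
    (k m n : I × J × L → ℕ) (eI : ∀ s, Fin (k s) × Fin (n s) → ι)
    (eJ : ∀ s, Fin (k s) × Fin (m s) → κ) (eL : ∀ s, Fin (m s) × Fin (n s) → μ)
    (εI : ∀ s, Fin (k s) × Fin (n s) → K) (εJ : ∀ s, Fin (k s) × Fin (m s) → K)
    (εL : ∀ s, Fin (m s) × Fin (n s) → K)
    (heI : ∀ s ∈ S, ∀ u, bI (eI s u) = s.1) (heJ : ∀ s ∈ S, ∀ v, bJ (eJ s v) = s.2.1)
    (heL : ∀ s ∈ S, ∀ w, bL (eL s w) = s.2.2)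
    (hεI : ∀ s ∈ S, ∀ u, εI s u * εI s u = 1) (hεJ : ∀ s ∈ S, ∀ v, εJ s v * εJ s v = 1)
    (hεL : ∀ s ∈ S, ∀ w, εL s w * εL s w = 1)
    (hmat : ∀ s ∈ S, ∀ u v w, t (eI s u) (eJ s v) (eL s w) =
      εI s u * εJ s v * εL s w * matMulTensor K (k s) (m s) (n s) u v w)
    {N p : ℕ} (d : Fin p → (Fin N → I) × (Fin N → J) × (Fin N → L))
    (hdS : ∀ i ρ, labelSeq (d i) ρ ∈ S)
    (hfree : ∀ i i' i'', (∀ ρ, ((d i).1 ρ, (d i').2.1 ρ, (d i'').2.2 ρ) ∈ S) → i = i' ∧ i' = i'') :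
    TensorRestrictsTo (kroneckerPow t N)
      (matMulDirectSum K (fun i => ∏ ρ, k (labelSeq (d i) ρ)) (fun i => ∏ ρ, m (labelSeq (d i) ρ))
        (fun i => ∏ ρ, n (labelSeq (d i) ρ))) := by
  have key : matMulDirectSum K (fun i => ∏ ρ, k (labelSeq (d i) ρ))
      (fun i => ∏ ρ, m (labelSeq (d i) ρ)) (fun i => ∏ ρ, n (labelSeq (d i) ρ)) =
      fun a b c =>
        (∏ ρ, εI (labelSeq (d a.1) ρ) (finPiFinEquiv.symm a.2.1 ρ, finPiFinEquiv.symm a.2.2 ρ)) *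
        (∏ ρ, εJ (labelSeq (d b.1) ρ) (finPiFinEquiv.symm b.2.1 ρ, finPiFinEquiv.symm b.2.2 ρ)) *
        (∏ ρ, εL (labelSeq (d c.1) ρ) (finPiFinEquiv.symm c.2.1 ρ, finPiFinEquiv.symm c.2.2 ρ)) *
        kroneckerPow t N (laserIndex₁ k n eI (labelSeq (d a.1)) a.2)
          (laserIndex₂ k m eJ (labelSeq (d b.1)) b.2) (laserIndex₃ m n eL (labelSeq (d c.1)) c.2) := by
    funext a b c
    exact matMulDirectSum_eq_signed_kroneckerPow_laserIndex t bI bJ bL S hS k m n eI eJ eL εI εJ εL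
      heI heJ heL hεI hεJ hεL hmat d hdS hfree a b c
  rw [key]
  exact tensorRestrictsTo_precomp_smul (kroneckerPow t N) _ _ _ _ _ _

end SignedFreeDiagonal

end Summit.MatrixMultiplication.MatrixMultiplication.Theorems

end
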